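import Summits.Ventures.YMGap.RobustBall.ParallelPairWitness
import Summits.Ventures.YMGap.RobustBall.ParallelPairFine
import Summits.Ventures.YMGap.RobustBall.TermPerturbationFine
import HarnessLib

/-!
# RobustBall/ParallelPairWitnessFine — T0.2 witness (w3) in the reads-incidence ball (`FineBall` upgrade)
(cell `pub-ymgap`, track Y2 ROBUST-BALL; p1)

HONEST FRAMING: a MEMBERSHIP CERTIFICATE (finite-torus bookkeeping only; no expansion, no continuum, no Clay claim):
the parallel-pair action of `RobustBall/ParallelPairWitness`, re-assembled on the MARKED polymers of
`RobustBall/ParallelPairFine` (same terms, same total), lies in the READS-incidence ball of `RobustBall/FineBall` with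
the sharper Lipschitz load `32(d−1)(d−2)|τ|/√N` — `ParallelPairWitnessFineTarget N d` AS TYPED (`3 ≤ L`). The marked
polymer determines the pair up to orientation (`pairCodeM_decode`), so fiber-mates read the same links
(`SameLinksOnFibers`) and share vertical windows.
-/

noncomputable section

open MeasureTheory Finset Function
open Literature.Probability.LatticeModels Literature.Probability.LatticeModels.DobrushinMetric
open Literature.MathematicalPhysics.QuantumLattice hiding torusNorm
open Literature.MathematicalPhysics.QuantumFieldTheory hiding ZdEdge

namespace Summit.Ventures.YMGap.RobustBall

variable {d L : ℕ} (N : ℕ) (τ : ℝ)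

/-! ### The family on marked polymers -/

variable (d L) in
/-- The pair terms of `pairFamily`, placed on the MARKED polymers `pairCodeM`. [folklore] -/
def pairFamilyM (r : Site d L × OTrip d) : LocalTerm d L N :=
  LocalTerm.ofPair N (τ / 2) (plaqWord r.1 r.2.1.1 r.2.1.2.1) (plaqWord (r.1 + unitVec r.2.1.2.2) r.2.1.1 r.2.1.2.1)
    (pairCodeM r.1 r.2.1.1 r.2.1.2.1 r.2.1.2.2) r.1 (r.1 + unitVec r.2.1.2.2)
    (isWalk_plaqWord r.1 _ _) (isWalk_plaqWord _ _ _)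
    fun _ hl => pairCode_subset_pairCodeM _ _ _ _ (site_mem_pairCode hl)

/-- Same activities as `pairFamily`. [folklore] -/
theorem pairFamilyM_act (r : Site d L × OTrip d) : (pairFamilyM d L N τ r).act = (pairFamily d L N τ r).act := rfl

/-- Same letters as `pairFamily`. [folklore] -/
@[simp] theorem pairFamilyM_letters (r : Site d L × OTrip d) :
    (pairFamilyM d L N τ r).letters = (pairFamily d L N τ r).letters := rfl

/-- The marked polymer. [folklore] -/
@[simp] theorem pairFamilyM_code (r : Site d L × OTrip d) :
    (pairFamilyM d L N τ r).code = pairCodeM r.1 r.2.1.1 r.2.1.2.1 r.2.1.2.2 := rfl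

/-- Oscillation constant `|τ|`. [folklore] -/
@[simp] theorem pairFamilyM_oscC (r : Site d L × OTrip d) : (pairFamilyM d L N τ r).oscC = |τ| := by
  show 2 * |τ / 2| = |τ|
  rw [abs_div, abs_two]; ring

/-- Lipschitz constant `|τ|/2/√N`. [folklore] -/
@[simp] theorem pairFamilyM_lipC (r : Site d L × OTrip d) : (pairFamilyM d L N τ r).lipC = |τ| / 2 / Real.sqrt N := by
  show |τ / 2| / Real.sqrt N = _
  rw [abs_div, abs_two]

/-- The links of a parallel pair do not depend on the orientation `(i, j) ↔ (j, i)`. [folklore] -/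
theorem wordEdges_pair_swap (x : Site d L) (i j k : Fin d) :
    wordEdges (plaqWord x j i ++ plaqWord (x + unitVec k) j i) = wordEdges (plaqWord x i j ++ plaqWord (x + unitVec k) i j) := by
  ext e
  simp only [mem_wordEdges, plaqWord, List.cons_append, List.nil_append, List.mem_cons, List.mem_nil_iff, or_false,
    exists_eq_or_imp, exists_eq_left, Letter.edge]
  tauto

/-- **Fiber-mates read the same links** (`3 ≤ L`): equal marked polymers carry the same pair of plaquettes. [folklore] -/
theorem sameLinksOnFibers_pairFamilyM (hL : 3 ≤ L) : SameLinksOnFibers (pairFamilyM d L N τ) := by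
  rintro ⟨x, ⟨i, j, k⟩, hij, hki, hkj⟩ ⟨x', ⟨i', j', k'⟩, hij', hki', hkj'⟩ h
  simp only [pairFamilyM_code] at h
  obtain ⟨rfl, rfl, hor⟩ := pairCodeM_decode hL hij hki hkj hij' hki' hkj' h
  simp only [pairFamilyM_letters, pairFamily_letters]
  rcases hor with ⟨rfl, rfl⟩ | ⟨rfl, rfl⟩
  · rfl
  · exact wordEdges_pair_swap x j i k

/-- Fiber-shared vertical windows (`3 ≤ L`): every fiber-mate has the same base point, so all its letters sit at
heights `x v, x v + 1`. [folklore] -/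
theorem window_pairFamilyM (hL : 3 ≤ L) (r : Site d L × OTrip d) (v : Fin d) :
    ∃ t₀ : ZMod L, ∀ r', (pairFamilyM d L N τ r').code = (pairFamilyM d L N τ r).code →
      ∀ l ∈ (pairFamilyM d L N τ r').letters, l.dir = v → ∃ k : ℕ, k < 2 ∧ l.site v = t₀ + k := by
  refine ⟨r.1 v, ?_⟩
  rintro ⟨x', ⟨i', j', k'⟩, hij', hki', hkj'⟩ h l hl -
  obtain ⟨x, ⟨i, j, k⟩, hij, hki, hkj⟩ := r
  simp only [pairFamilyM_code] at h
  obtain ⟨hx, -, -⟩ := pairCodeM_decode hL hij' hki' hkj' hij hki hkj h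
  have hsite : l.site ∈ pairCode x' i' j' k' := site_mem_pairCode hl
  rcases apply_mem_pairCode hki' hkj' hsite v with h' | h'
  · exact ⟨0, by norm_num, by simp [h', hx]⟩
  · exact ⟨1, by norm_num, by simp [h', hx]⟩

variable [NeZero L]

/-- **Total** of the marked pair perturbation: the typed parallel-pair action (same terms as `pairFamily`). [folklore] -/
theorem total_pairFamilyM (U : GaugeConfig d L (SUN N)) :
    (termPerturbation (pairFamilyM d L N τ)).total U =
      ∑ x : Site d L, ∑ i : Fin d, ∑ j : Fin d, ∑ k : Fin d,
        if i < j ∧ k ≠ i ∧ k ≠ j then parallelPairActivity N τ x i j k U else 0 := by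
  rw [total_termPerturbation, ← total_pairFamily N τ U, total_termPerturbation]
  rfl

/-- **The link count** (reads incidence): `Σ_{r : e ∈ links r} (|τ|/(2√N))·8 ≤ (4|τ|/√N)·Σ_r mult_r(e) = 32(d−1)(d−2)|τ|/√N`.
[folklore] -/
theorem sum_link_pairFamilyM_le (e : Edge d L) :
    ∑ r, (if e ∈ wordEdges (pairFamilyM d L N τ r).letters then
        (pairFamilyM d L N τ r).lipC * ((pairFamilyM d L N τ r).letters.length : ℝ) else 0) ≤
      32 * ((d : ℝ) - 1) * ((d : ℝ) - 2) * |τ| / Real.sqrt N := by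
  have hc : 0 ≤ |τ| / 2 / Real.sqrt N := by positivity
  have hle : ∀ r : Site d L × OTrip d,
      (if e ∈ wordEdges (pairFamilyM d L N τ r).letters then
          (pairFamilyM d L N τ r).lipC * ((pairFamilyM d L N τ r).letters.length : ℝ) else 0) ≤
        8 * (|τ| / 2 / Real.sqrt N) * (mult (pairFamily d L N τ r).letters e : ℝ) := by
    intro r
    simp only [pairFamilyM_letters, pairFamilyM_lipC, length_pairFamily_letters, Nat.cast_ofNat]
    split_ifs with h
    · have h1 : 1 ≤ mult (pairFamily d L N τ r).letters e :=
        Nat.one_le_iff_ne_zero.2 fun h0 => (mult_eq_zero_iff.1 h0) h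
      have h1' : (1 : ℝ) ≤ mult (pairFamily d L N τ r).letters e := by exact_mod_cast h1
      nlinarith
    · positivity
  calc ∑ r, (if e ∈ wordEdges (pairFamilyM d L N τ r).letters then
          (pairFamilyM d L N τ r).lipC * ((pairFamilyM d L N τ r).letters.length : ℝ) else 0)
      ≤ ∑ r : Site d L × OTrip d, 8 * (|τ| / 2 / Real.sqrt N) * (mult (pairFamily d L N τ r).letters e : ℝ) :=
        sum_le_sum fun r _ => hle r
    _ = 32 * ((d : ℝ) - 1) * ((d : ℝ) - 2) * |τ| / Real.sqrt N := by
        rw [← mul_sum, sum_mult_pairFamily_real]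
        ring

/-- **Membership in the reads-incidence ball** (`3 ≤ L`): the marked pair perturbation lies in
`ClusterDomainFRFine (8(d−1)(d−2)|τ|) (32(d−1)(d−2)|τ|/√N) 2`. [folklore] -/
theorem pairFamilyM_mem_clusterDomainFRFine (hL : 3 ≤ L) :
    termPerturbation (pairFamilyM d L N τ) ∈
      ClusterDomainFRFine (8 * ((d : ℝ) - 1) * ((d : ℝ) - 2) * |τ|)
        (32 * ((d : ℝ) - 1) * ((d : ℝ) - 2) * |τ| / Real.sqrt N) 2 := by
  refine termPerturbation_mem_clusterDomainFRFine (pairFamilyM d L N τ) (sameLinksOnFibers_pairFamilyM N τ hL)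
    (fun r => polymerDiam_pairCodeM_le r.2.2.2.1 r.2.2.2.2) (fun e => ?_) (fun e => sum_link_pairFamilyM_le N τ e)
  simp only [pairFamilyM_oscC, pairFamilyM_letters]
  rw [← mul_sum, sum_mult_pairFamily_real]
  linarith [abs_nonneg τ]

/-- **Vertical dependence diameter `2`** of the marked pair perturbation (`3 ≤ L`). [folklore] -/
theorem hasVertRange_pairFamilyM (hL : 3 ≤ L) : HasVertRange 2 (termPerturbation (pairFamilyM d L N τ)) :=
  hasVertRange_termPerturbation_of_fibers (pairFamilyM d L N τ) (window_pairFamilyM N τ hL)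

/-- **Slab-locality** of the marked pair perturbation (`3 ≤ L`). [folklore] -/
theorem isSlabLocal_pairFamilyM (hL : 3 ≤ L) : IsSlabLocal 2 (termPerturbation (pairFamilyM d L N τ)) :=
  isSlabLocal_termPerturbation_of_fibers (pairFamilyM d L N τ)
    (fun r v t _z hz U =>
      pairActivity_centerSlabRotate (netCount_plaqWord r.2.2.1) (netCount_plaqWord r.2.2.1) (τ / 2) v t hz U)
    (window_pairFamilyM N τ hL)

/-- **T0.2 witness (w3) in the READS-incidence ball** (`RobustBall/FineBall`), with the loads of
`ParallelPairWitnessFineTarget` AS TYPED: oscillation load `8(d−1)(d−2)|τ|`, Lipschitz load `32(d−1)(d−2)|τ|/√N`,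
range `2`, vertical dependence diameter `2`, centre-slab invariant — for every `τ`, `N`, `d` and every torus `L ≥ 3`.
[folklore] -/
theorem parallelPairWitnessFineTarget_holds (N d : ℕ) : ParallelPairWitnessFineTarget N d := by
  intro τ L _ hL
  exact ⟨termPerturbation (pairFamilyM d L N τ), total_pairFamilyM N τ, pairFamilyM_mem_clusterDomainFRFine N τ hL,
    hasVertRange_pairFamilyM N τ hL, isSlabLocal_pairFamilyM N τ hL⟩

end Summit.Ventures.YMGap.RobustBall

end
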